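import Literature.NumberTheory.Irrationality.Fischler2002.RhinViolaGroupsGeneral
import Literature.NumberTheory.Irrationality.RhinViola2001.ThetaInvarianceLIntegralProofs
import HarnessLib

/-!
# Fischler 2002, Théorème 3.2 — the `n = 3` DICTIONARY with Rhin–Viola 2001, and the `ϑ`-invariance of `𝒥₃` on `𝓔₃`

Topic `Literature/NumberTheory/Irrationality/Fischler2002`. PROOFS ONLY (no definition, no statement). First brick toward the LAST
case (`n = 3`) of the named fact `theoreme32` (`RhinViolaGroupsGeneral.lean`; every `n ≠ 3` is the tree's `theoreme32_of_ne_three`,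
seat ct-1 g33). Fischler [Fischler2003RhinViola, §3.4 Théorème 6]: for `n = 3` the group `G = ⟨σ, ψ, φ⟩` "est isomorphe à
`H ⋊ 𝔖₅`", which is Rhin–Viola's group `Φ` for `ζ(3)` [RhinViola2001, §4]. This file makes the identification at the level of the
FAMILIES, not only of the groups: for `p = (a; b; c₃)` with `c₂ = 0` (in particular on `𝓔₃`),

  `𝒥₃(p) = ∫⁻_{(0,1)³} ( x^h (1−x)^l y^k (1−y)^s z^j (1−z)^q / (1−(1−xy)z)^{q+h−r+1} )⁺ dx dy dz`,
  `(h, j, k, l, m, q, r, s) = (b₁, a₃, a₂, a₁, a₂+b₃−c₃, b₃, b₁+b₃−c₃, b₂)`,  `q + h − r = c₃`,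

i.e. `𝒥₃(p)` is Rhin–Viola's integral (2.1) `I(h,j,k,l,m,q,r,s)` read in `ℝ₊ ∪ {∞}` (`Jn_three_eq_lintegral_rv`): the change of
variables is `x = 1 − x₁`, `y = x₂`, `z = x₃` (then `δ₃ = 1 − x₃(1 − x₂(1−x₁)) = 1 − (1−xy)z`), and `[0,1]³` versus `(0,1)³` is a
null set. Rhin–Viola's balance (2.2) `h+m = k+r` is automatic and (2.3) `j+q = l+s` is EXACTLY the relation `a₁+b₂ = a₃+b₃` defining
`𝓔₃`; the eight parameters are EXACTLY the eight arguments of the normaliser `rvNormaliser 3`, and Fischler's finiteness criterion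
on `𝓔₃` is their non-negativity. CONSEQUENCE (`Jn_three_theta`): Rhin–Viola's birational change of variables `ϑ` (period 8; the
tree's `ThetaInvariance.lintegral_theta`, no sign hypothesis) acts on `𝓔₃`:
`𝒥₃(a₂+b₃−c₃, a₁, a₂ ; a₃, b₁, b₁+b₃−c₃ ; c₃' = a₃+b₁+b₃−b₂−c₃) = 𝒥₃(a₁,a₂,a₃ ; b₁,b₂,b₃ ; c₃)` — an EXACT invariance beyond
`σ, ψ` which is the word `φσφσψσφσφσψσφ` in Fischler's generators (next bricks) and which supplies the missing links between the
criterion points of an orbit (ct-1 g33's recon memo §5: transport along `σ, ψ, φ` alone is disconnected for `n = 3`).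
Cell `pub-zeta5`, seat ct-1 g34, 2026-08-28. [cite: Fischler2002Polyzetas, §3 Théorème 3.2] [cite: RhinViola2001, §2 (2.1), p. 272]

HONEST FRAMING (cell pub-zeta5): systematic search; no irrationality claim unless certified — identities between (possibly infinite)
integrals of non-negative functions; nothing about `ζ(5)` (nor about the arithmetic of `ζ(3)`).
-/

noncomputable section

namespace Literature.NumberTheory.Irrationality.Fischler2002

namespace Theoreme32

open MeasureTheory Set
open scoped ENNReal

/-! ### Plumbing for `n = 3` -/

/-- `∏_{k=1}^{3} f k = f 1 · f 2 · f 3`. [folklore] -/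
private theorem prod_Icc_one_three' (f : ℕ → ℝ) : ∏ k ∈ Finset.Icc 1 3, f k = f 1 * f 2 * f 3 := by
  rw [show Finset.Icc 1 3 = {1, 2, 3} by decide, Finset.prod_insert (by decide), Finset.prod_insert (by decide),
    Finset.prod_singleton, mul_assoc]

/-- `∏_{k=2}^{3} f k = f 2 · f 3`. [folklore] -/
private theorem prod_Icc_two_three' (f : ℕ → ℝ) : ∏ k ∈ Finset.Icc 2 3, f k = f 2 * f 3 := by
  rw [show Finset.Icc 2 3 = {2, 3} by decide, Finset.prod_insert (by decide), Finset.prod_singleton]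

/-- `x₁ = w 0`. [folklore] -/
private theorem coord_one (w : Fin 3 → ℝ) : coord w 1 = w 0 := by
  simp [coord]

/-- `x₂ = w 1`. [folklore] -/
private theorem coord_two (w : Fin 3 → ℝ) : coord w 2 = w 1 := by
  simp only [coord, show (1:ℕ) ≤ 2 ∧ 2 ≤ 3 by omega, and_self, dite_true]
  rfl

/-- `x₃ = w 2`. [folklore] -/
private theorem coord_three (w : Fin 3 → ℝ) : coord w 3 = w 2 := by
  simp only [coord, show (1:ℕ) ≤ 3 ∧ 3 ≤ 3 by omega, and_self, dite_true]
  rfl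

/-- `δ₃(w) = 1 − w₂(1 − w₁(1 − w₀))`. [cite: Fischler2002Polyzetas, §3 p. 3 (δ_k = 1 − x_k δ_{k−1})] -/
private theorem deltaV_three (w : Fin 3 → ℝ) : deltaV w 3 = 1 - w 2 * (1 - w 1 * (1 - w 0)) := by
  show 1 - coord w 3 * (1 - coord w 2 * (1 - coord w 1 * 1)) = _
  rw [coord_one, coord_two, coord_three, mul_one]

/-- `δ₂(w) = 1 − w₁(1 − w₀)`. [cite: Fischler2002Polyzetas, §3 p. 3 (δ_k = 1 − x_k δ_{k−1})] -/
private theorem deltaV_two (w : Fin 3 → ℝ) : deltaV w 2 = 1 - w 1 * (1 - w 0) := by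
  show 1 - coord w 2 * (1 - coord w 1 * 1) = _
  rw [coord_one, coord_two, mul_one]

/-- The integrand of `𝒥₃(p)` (with `c₂ = 0`) at `w` is Rhin–Viola's integrand (2.1) of
`(b₁, a₃, a₂, a₁, a₂+b₃−c₃, b₃, b₁+b₃−c₃, b₂)` at `(1 − w₀, w₁, w₂)`, on the open cube.
[cite: Fischler2002Polyzetas, §3 p. 3 (definition of 𝒥(p))] [cite: RhinViola2001, §2 (2.1)] -/
theorem integrandJ_three_eq_rv (p : Exponents) (hc2 : p.c 2 = 0) {w : Fin 3 → ℝ} (hw : w ∈ RhinViola2001.cube) :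
    integrandJ 3 p w =
      RhinViola2001.integrand ⟨p.b 1, p.a 3, p.a 2, p.a 1, p.a 2 + p.b 3 - p.c 3, p.b 3, p.b 1 + p.b 3 - p.c 3, p.b 2⟩
        (fun i => if i = 0 then 1 - w i else w i) := by
  have h0 := hw 0; have h1 := hw 1; have h2 := hw 2
  have hδ : 0 < 1 - w 2 * (1 - w 1 * (1 - w 0)) := by
    have : w 1 * (1 - w 0) < 1 := by nlinarith [h0.1, h0.2, h1.1, h1.2]
    have : 0 ≤ w 1 * (1 - w 0) := mul_nonneg h1.1.le (by linarith [h0.2])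
    nlinarith [h2.1, h2.2]
  unfold integrandJ RhinViola2001.integrand
  rw [prod_Icc_one_three', prod_Icc_two_three', coord_one, coord_two, coord_three, deltaV_three, deltaV_two, hc2, zpow_zero,
    one_mul]
  simp only [Fin.isValue, if_true, show (1 : Fin 3) ≠ 0 by decide, show (2 : Fin 3) ≠ 0 by decide, if_false, sub_sub_cancel]
  rw [show p.b 3 + p.b 1 - (p.b 1 + p.b 3 - p.c 3) + 1 = p.c 3 + 1 by ring,
    show 1 - (1 - (1 - w 0) * w 1) * w 2 = 1 - w 2 * (1 - w 1 * (1 - w 0)) by ring, zpow_add_one₀ hδ.ne', div_div]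
  ring

/-! ### `[0,1]³` versus `(0,1)³`, and the flip `x₁ ↦ 1 − x₁` -/

/-- The closed cube `[0,1]³` and Rhin–Viola's open cube `(0,1)³` differ by a null set. [folklore] -/
private theorem unitCube_ae_eq_cube : (RhinViola2001.cube : Set (Fin 3 → ℝ)) =ᵐ[volume] unitCube 3 := by
  rw [RhinViola2001.ThetaInvariance.cube_eq_pi, unitCube, MeasureTheory.volume_pi]
  exact Measure.pi_Ioo_ae_eq_pi_Icc (μ := fun _ : Fin 3 => (volume : Measure ℝ)) (f := fun _ => (0 : ℝ))
    (g := fun _ => (1 : ℝ))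

/-- The flip `(w₀, w₁, w₂) ↦ (1 − w₀, w₁, w₂)` preserves Lebesgue measure on `ℝ³`. [folklore] -/
private theorem measurePreserving_flip :
    MeasurePreserving (fun (w : Fin 3 → ℝ) (i : Fin 3) => if i = 0 then 1 - w i else w i) volume volume := by
  let f : Fin 3 → ℝ → ℝ := fun i s => if i = 0 then 1 - s else s
  have hf : ∀ i, MeasurePreserving (f i) volume volume := by
    intro i
    by_cases h : i = 0
    · have e : f i = fun s => 1 - s := by funext s; simp [f, h]
      rw [e]; exact Measure.measurePreserving_sub_left volume 1
    · have e : f i = id := by funext s; simp [f, h]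
      rw [e]; exact MeasurePreserving.id volume
  exact volume_preserving_pi hf

/-- The flip is an involution. [folklore] -/
private theorem flip_involutive :
    Function.Involutive (fun (w : Fin 3 → ℝ) (i : Fin 3) => if i = 0 then 1 - w i else w i) := by
  intro w; funext i
  by_cases h : i = 0
  · simp [h]
  · simp [h]

/-- The flip is measurable. [folklore] -/
private theorem measurable_flip :
    Measurable (fun (w : Fin 3 → ℝ) (i : Fin 3) => if i = 0 then 1 - w i else w i) := by
  refine measurable_pi_iff.mpr fun i => ?_
  by_cases h : i = 0
  · simp only [h, if_true]; fun_prop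
  · simp only [h, if_false]; exact measurable_pi_apply i

/-- The flip maps the open cube onto itself. [folklore] -/
private theorem flip_preimage_cube :
    (fun (w : Fin 3 → ℝ) (i : Fin 3) => if i = 0 then 1 - w i else w i) ⁻¹' RhinViola2001.cube = RhinViola2001.cube := by
  ext w
  simp only [Set.mem_preimage, RhinViola2001.cube, Set.mem_setOf_eq, Set.mem_Ioo]
  constructor
  · intro h i
    have hi := h i
    by_cases e : i = 0
    · subst e; simp only [if_true] at hi; constructor <;> linarith [hi.1, hi.2]
    · simpa [e] using hi
  · intro h i
    have hi := h i
    by_cases e : i = 0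
    · subst e; simp only [if_true]; constructor <;> linarith [hi.1, hi.2]
    · simpa [e] using hi

/-! ### The dictionary -/

/-- **`𝒥₃(p)` is Rhin–Viola's `I(b₁, a₃, a₂, a₁, a₂+b₃−c₃, b₃, b₁+b₃−c₃, b₂)` in `ℝ₊ ∪ {∞}`** (for `c₂ = 0`, in particular on
`𝓔₃`): `Jn 3 p = ∫⁻_{(0,1)³} (Rhin–Viola's integrand (2.1))⁺`, via `x = 1 − x₁, y = x₂, z = x₃` and `[0,1]³ =ᵐ (0,1)³`.
[cite: Fischler2002Polyzetas, §3 p. 3 (definition of 𝒥(p)), Théorème 3.2 (n = 3: G ≅ H ⋊ 𝔖₅)] [cite: RhinViola2001, §2 (2.1)] -/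
theorem Jn_three_eq_lintegral_rv (p : Exponents) (hc2 : p.c 2 = 0) :
    Jn 3 p = ∫⁻ w in RhinViola2001.cube, ENNReal.ofReal
      (RhinViola2001.integrand ⟨p.b 1, p.a 3, p.a 2, p.a 1, p.a 2 + p.b 3 - p.c 3, p.b 3, p.b 1 + p.b 3 - p.c 3, p.b 2⟩ w) := by
  set P : RhinViola2001.Params :=
    ⟨p.b 1, p.a 3, p.a 2, p.a 1, p.a 2 + p.b 3 - p.c 3, p.b 3, p.b 1 + p.b 3 - p.c 3, p.b 2⟩ with hP
  let F : (Fin 3 → ℝ) → (Fin 3 → ℝ) := fun w i => if i = 0 then 1 - w i else w i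
  have hemb : MeasurableEmbedding F :=
    (MeasurableEquiv.ofInvolutive F flip_involutive measurable_flip).measurableEmbedding
  have key : ∫⁻ w in RhinViola2001.cube, ENNReal.ofReal (RhinViola2001.integrand P (F w)) =
      ∫⁻ w in RhinViola2001.cube, ENNReal.ofReal (RhinViola2001.integrand P w) := by
    have h := measurePreserving_flip.setLIntegral_comp_preimage_emb hemb
      (fun w => ENNReal.ofReal (RhinViola2001.integrand P w)) RhinViola2001.cube
    rw [flip_preimage_cube] at h
    exact h
  unfold Jn
  rw [← setLIntegral_congr unitCube_ae_eq_cube, ← key]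
  refine setLIntegral_congr_fun RhinViola2001.ThetaInvariance.measurableSet_cube fun w hw => ?_
  show ENNReal.ofReal (integrandJ 3 p w) = ENNReal.ofReal (RhinViola2001.integrand P (F w))
  rw [integrandJ_three_eq_rv p hc2 hw]

/-- The Rhin–Viola parameters of a point of `𝓔₃` are balanced ((2.2) is automatic, (2.3) is `a₁+b₂ = a₃+b₃`).
[cite: RhinViola2001, §2 (2.2)–(2.3)] [cite: Fischler2002Polyzetas, §3 p. 4 (definition of 𝓔, n = 3)] -/
theorem rv_balanced_of_InE (p : Exponents) (hE : p.a 1 + p.b 2 = p.a 3 + p.b 3) :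
    (⟨p.b 1, p.a 3, p.a 2, p.a 1, p.a 2 + p.b 3 - p.c 3, p.b 3, p.b 1 + p.b 3 - p.c 3, p.b 2⟩ : RhinViola2001.Params).Balanced := by
  constructor
  · show p.b 1 + (p.a 2 + p.b 3 - p.c 3) = p.a 2 + (p.b 1 + p.b 3 - p.c 3); ring
  · show p.a 3 + p.b 3 = p.a 1 + p.b 2; rw [hE]

/-! ### The `ϑ`-invariance of `𝒥₃` on `𝓔₃` -/

/-- **Rhin–Viola's `ϑ` acts on Fischler's family (`n = 3`, `𝓔₃`):** if `p = (a₁,a₂,a₃; b₁,b₂,b₃; c₂ = 0, c₃)` satisfies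
`a₁+b₂ = a₃+b₃` and `q` has `c₂ = 0` and live coordinates
`(a₂+b₃−c₃, a₁, a₂ ; a₃, b₁, b₁+b₃−c₃ ; c₃' = a₃+b₁+b₃−b₂−c₃)`, then `𝒥₃(q) = 𝒥₃(p)` in `ℝ₊ ∪ {∞}` — under the dictionary,
`q`'s parameters are `ϑ(h,j,k,l,m,q,r,s) = (j,k,l,m,q,r,s,h)` and the identity is the tree's `ThetaInvariance.lintegral_theta` (the
change of variables `ϑ⁻¹` (2.6), no sign or convergence hypothesis).
[cite: RhinViola2001, §2 p. 272 ((2.4)–(2.6))] [cite: Fischler2002Polyzetas, §3 Théorème 3.2 (n = 3)] -/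
theorem Jn_three_theta (p q : Exponents) (hp2 : p.c 2 = 0) (hq2 : q.c 2 = 0) (hE : p.a 1 + p.b 2 = p.a 3 + p.b 3)
    (ha1 : q.a 1 = p.a 2 + p.b 3 - p.c 3) (ha2 : q.a 2 = p.a 1) (ha3 : q.a 3 = p.a 2)
    (hb1 : q.b 1 = p.a 3) (hb2 : q.b 2 = p.b 1) (hb3 : q.b 3 = p.b 1 + p.b 3 - p.c 3)
    (hc3 : q.c 3 = p.a 3 + p.b 1 + p.b 3 - p.b 2 - p.c 3) : Jn 3 q = Jn 3 p := by
  rw [Jn_three_eq_lintegral_rv q hq2, Jn_three_eq_lintegral_rv p hp2]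
  have hθ : (⟨q.b 1, q.a 3, q.a 2, q.a 1, q.a 2 + q.b 3 - q.c 3, q.b 3, q.b 1 + q.b 3 - q.c 3, q.b 2⟩ : RhinViola2001.Params) =
      RhinViola2001.theta ⟨p.b 1, p.a 3, p.a 2, p.a 1, p.a 2 + p.b 3 - p.c 3, p.b 3, p.b 1 + p.b 3 - p.c 3, p.b 2⟩ := by
    simp only [RhinViola2001.theta, RhinViola2001.Params.mk.injEq]
    refine ⟨hb1, ha3, ha2, ha1, ?_, hb3, ?_, hb2⟩
    · rw [ha2, hb3, hc3]; linarith
    · rw [hb1, hb3, hc3]; ring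
  rw [hθ]
  exact RhinViola2001.ThetaInvariance.lintegral_theta _ (rv_balanced_of_InE p hE)

/-- The same, read on the subtype `𝓔₃`: for `p ∈ 𝓔₃` and any `q ∈ 𝓔₃` with the displayed live coordinates, `𝒥₃(q) = 𝒥₃(p)`.
[cite: RhinViola2001, §2 p. 272 ((2.4)–(2.6))] [cite: Fischler2002Polyzetas, §3 Théorème 3.2 (n = 3)] -/
theorem Jn_three_theta_of_InE {p q : Exponents} (hp : InE 3 p) (hq : InE 3 q)
    (ha1 : q.a 1 = p.a 2 + p.b 3 - p.c 3) (ha2 : q.a 2 = p.a 1) (ha3 : q.a 3 = p.a 2)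
    (hb1 : q.b 1 = p.a 3) (hb2 : q.b 2 = p.b 1) (hb3 : q.b 3 = p.b 1 + p.b 3 - p.c 3)
    (hc3 : q.c 3 = p.a 3 + p.b 1 + p.b 3 - p.b 2 - p.c 3) : Jn 3 q = Jn 3 p :=
  Jn_three_theta p q (hp.1 2 le_rfl (by norm_num)) (hq.1 2 le_rfl (by norm_num)) (hp.2.1 rfl) ha1 ha2 ha3 hb1 hb2 hb3 hc3

end Theoreme32

end Literature.NumberTheory.Irrationality.Fischler2002

end
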